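import Summits.QuantumFields.QCD.Theorems.QuarksAsStableActionCriticalLineDiamagnetismRouteBAlgebra
import Summits.QuantumFields.QCD.Theorems.QuarksAsStableActionCriticalLineDiamagnetismRectPattern
import Summits.QuantumFields.QCD.Theorems.QuarksAsStableActionCriticalLineDiamagnetismRectFreqOpStatic
import Summits.QuantumFields.QCD.Theorems.QuarksAsStableActionCriticalLineDiamagnetismRectFreqOpTransfer
import Summits.QuantumFields.QCD.Theorems.QuarksAsStableActionCriticalLineDiamagnetismStaticPressureOdd

/-!
# Route B helper `reflectionChain` for stub `stub_heavyFrequencyGain` of line `Sketch` — ONE application of the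
reflection-positivity chain on the rectangular two-torus `ℤ/(2n+1) × ℤ/L₂` (odd time length)
(crux `Summit.QuantumFields.QCD.Theses.QuarksAsStableAction.CriticalLineDiamagnetism`, item stmt-QuantumFields-9734,
static route for odd tori, Route B of the heavy-frequency gain)

For a field `A : ℤ/(2n+1) → ℤ/L₂ → Fin 4 → U(3)` (`n ≥ 1`), `m > −1`, a real frequency pair and a real `πf` with
`log e_s + p(M_s) ≤ πf` for every row `s` (`e_s = ‖det (A_sP⁻ − P⁺)‖` the `E`-factor, `M_s = oneStepR A s` Lüscher's
dressed one-step matrix, `p(M) = Σᵢ log max(μᵢ(M), 1)` the pressure), and `det D_A ≠ 0` for the time form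
`D_A = tfreqOpR A m ω₀ ω₁`, at every reflection row `r`:
`log ‖det D_A‖ ≤ πf + (1/2n) Σ_{s ≠ r+n} log ‖det D_{pat_s}‖`,
where `pat_s` is the closed-slab pattern of rows `s, s+1` on `ℤ/(2n) × ℤ/L₂` (the field of `rectPattern`): the
plaquettes between the rows `r + n`, `r + n + 1` are sacrificed.

Proof (composition of tree facts):
* Lüscher's transfer form `det D_A = (∏_t det E_t) · det (1 − Ω)`, `Ω = ∏_{i<2n+1} M_i W_i`, `M_i > 0`
  (`tfreqOpR_det_transfer_form`), with `‖det E_t‖ = e_t` (`stub_normDetChainBlock`) and `e_t > 0`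
  (`norm_det_sliceE_pos`);
* the abstract chain `routeBAlgebra` with the letters `M_i = oneStepR A i` and `W_i = −link2R A i` (unitary): on the odd
  circle `∏ M_i (−W_i) = −Ω`, so its left side is `(‖det (1 − Ω)‖²)^n`; and `(−W_s)ᴴ M_s (−W_s) = W̃_sᴴ M_s W̃_s` for the
  UNSIGNED transporter `W̃_s = A(s,·,2) ⊗ 1_spin` (`link2R A s = ±W̃_s`), so its pure tiling terms are
  `T_s = Re det (1 + (W̃_sᴴ M_s W̃_s M_{s+1})^n) ≥ 1`;
* `‖det D_{pat_s}‖ = e_s^n e_{s+1}^n T_s` (`rectPattern`);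
* logarithms, `log p_s ≤ πf − log e_s` at the two defect rows, and the row bookkeeping (`bookkeeping`): the rows other
  than `r + n` are `{r + t}_{t<n} ∪ {r + n + 1 + t}_{t<n}` (`sum_rows_split`) and every `log e_t` is counted `2n` times.
Pure theorem file (no definitions).  References: M. Lüscher, Commun. Math. Phys. 54 (1977) 283; J. Fröhlich, R. Israel,
E. H. Lieb, B. Simon, Commun. Math. Phys. 62 (1978) 1; E. Seiler, *Gauge Theories as a Problem of Constructive Quantum
Field Theory and Statistical Mechanics*, Lecture Notes in Physics 159 (1982).
-/

noncomputable section

open scoped BigOperators Matrix ComplexConjugate ComplexOrder MatrixOrder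
open Finset
open Literature.MathematicalPhysics.QuantumLattice Literature.MathematicalPhysics.QuantumFieldTheory
  Literature.Probability.LatticeModels

namespace Summit.QuantumFields.QCD.Cruxes.CriticalLineDiamagnetism.ChessboardCellGain

namespace FrequencyDiamagnetism

namespace ReflectionChain

open Matrix Complex
open Summit.QuantumFields.QCD.Cruxes.StableActionBridge.Sketch
open Summit.QuantumFields.QCD.Cruxes.WilsonQuarkStability.FreeTangentLandauChessboard

/-! ### Sums over `ℤ/(2n+1)` split at a reflection row -/

/-- For `N ≥ 1`, a sum over `ZMod N` is the sum over the residues of `0, 1, …, N − 1`. -/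
theorem sum_univ_zmod_eq_sum_range {M : Type*} [AddCommMonoid M] (N : ℕ) [NeZero N] (c : ZMod N → M) :
    ∑ s : ZMod N, c s = ∑ i ∈ Finset.range N, c (i : ZMod N) := by
  -- adapted from `RectPattern.prod_univ_zmod_eq_prod_range` (…CriticalLineDiamagnetismRectPattern.lean)
  obtain ⟨k, rfl⟩ : ∃ k, N = k + 1 := ⟨N - 1, (Nat.sub_one_add_one_eq_of_pos (NeZero.pos N)).symm⟩
  rw [← Fin.sum_univ_eq_sum_range (fun i : ℕ => c i) (k + 1)]
  exact Fintype.sum_congr _ _ fun i => congrArg c (ZMod.natCast_zmod_val (n := k + 1) i).symm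

/-- The rows of `ℤ/(2n+1)` other than `r + n` are `r, …, r + n − 1` and `r + n + 1, …, r + 2n`:
`Σ_{t<n} f (r + t) + Σ_{t<n} f (r + n + 1 + t) = Σ_{s ≠ r + n} f s`. -/
theorem sum_rows_split (n : ℕ) (r : ZMod (2 * n + 1)) (f : ZMod (2 * n + 1) → ℝ) :
    ∑ t : Fin n, f (r + t) + ∑ t : Fin n, f (r + n + 1 + t) = ∑ s ∈ Finset.univ.erase (r + n), f s := by
  have hrange : Finset.range (2 * n + 1) = Finset.range (n + 1 + n) := congrArg Finset.range (by ring)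
  have huniv : ∑ s, f s =
      (∑ i ∈ Finset.range n, f (r + i) + f (r + n)) + ∑ i ∈ Finset.range n, f (r + n + 1 + i) := by
    rw [← Fintype.sum_equiv (Equiv.addLeft r) (fun s => f (r + s)) f (fun s => rfl),
      sum_univ_zmod_eq_sum_range, hrange, Finset.sum_range_add, Finset.sum_range_succ]
    congr 1
    refine Finset.sum_congr rfl fun i _ => congrArg f ?_
    push_cast
    ring
  rw [Finset.sum_erase_eq_sub (Finset.mem_univ _), huniv, Fin.sum_univ_eq_sum_range (fun i => f (r + i)) n,
    Fin.sum_univ_eq_sum_range (fun i => f (r + n + 1 + i)) n]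
  ring

/-- **Row bookkeeping of one application of Route B** (pure real arithmetic).  With `lD = Σ_t le_t + lΩ`
(transfer form), `2n·lΩ ≤ n (lp_{r+n} + lp_{r+n+1}) + Σ_{t<n} lT_{r+t} + Σ_{t<n} lT_{r+n+1+t}` (the chain),
`lpat_s = n le_s + n le_{s+1} + lT_s` (the slab patterns) and `le_s + lp_s ≤ πf` (the pressures),
`lD ≤ πf + (1/2n) Σ_{s ≠ r+n} lpat_s`: every row's `le` is counted exactly `2n` times. -/
theorem bookkeeping {n : ℕ} (hn : 0 < n) (r : ZMod (2 * n + 1)) (le lp lT lpat : ZMod (2 * n + 1) → ℝ)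
    (lΩ lD πf : ℝ) (hD : lD = ∑ t, le t + lΩ)
    (hB : (n : ℝ) * (2 * lΩ) ≤
      n * (lp (r + n) + lp (r + n + 1)) + ∑ t : Fin n, lT (r + t) + ∑ t : Fin n, lT (r + n + 1 + t))
    (hpat : ∀ s, lpat s = n * le s + n * le (s + 1) + lT s) (hπ : ∀ s, le s + lp s ≤ πf) :
    lD ≤ πf + (1 / (2 * n : ℝ)) * ∑ s ∈ Finset.univ.erase (r + n), lpat s := by
  have h2n : (0 : ℝ) < 2 * n := by positivity
  have hS : ∑ s ∈ Finset.univ.erase (r + n), lpat s =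
      n * (∑ t, le t - le (r + n)) + n * (∑ t, le t - le (r + n + 1)) +
        (∑ t : Fin n, lT (r + t) + ∑ t : Fin n, lT (r + n + 1 + t)) := by
    have h1 : ∑ s ∈ Finset.univ.erase (r + n), le s = ∑ t, le t - le (r + n) :=
      Finset.sum_erase_eq_sub (Finset.mem_univ _)
    have h2 : ∑ s ∈ Finset.univ.erase (r + n), le (s + 1) = ∑ t, le t - le (r + n + 1) := by
      rw [Finset.sum_erase_eq_sub (Finset.mem_univ _),
        Fintype.sum_equiv (Equiv.addRight 1) (fun s => le (s + 1)) le fun s => rfl]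
    rw [Finset.sum_congr rfl fun s _ => hpat s, Finset.sum_add_distrib, Finset.sum_add_distrib,
      ← Finset.mul_sum, ← Finset.mul_sum, h1, h2, sum_rows_split n r lT]
  have hmain : (2 * n : ℝ) * lD ≤ (2 * n : ℝ) * πf + ∑ s ∈ Finset.univ.erase (r + n), lpat s := by
    rw [hS, hD]
    have hn0 : (0 : ℝ) ≤ n := Nat.cast_nonneg n
    have hπ1 := mul_le_mul_of_nonneg_left (hπ (r + n)) hn0
    have hπ2 := mul_le_mul_of_nonneg_left (hπ (r + n + 1)) hn0
    linarith
  rw [show πf + 1 / (2 * n : ℝ) * ∑ s ∈ Finset.univ.erase (r + n), lpat s =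
      ((2 * n : ℝ) * πf + ∑ s ∈ Finset.univ.erase (r + n), lpat s) / (2 * n : ℝ) by
    field_simp]
  rw [le_div_iff₀ h2n]
  linarith

/-! ### Small matrix facts -/

/-- The negative of a unitary matrix is unitary. -/
theorem neg_mem_unitaryGroup {k : Type*} [Fintype k] [DecidableEq k] {U : Matrix k k ℂ}
    (hU : U ∈ Matrix.unitaryGroup k ℂ) : -U ∈ Matrix.unitaryGroup k ℂ := by
  rw [Matrix.mem_unitaryGroup_iff] at hU ⊢
  rw [star_neg, neg_mul_neg, hU]

/-- For positive semidefinite `P`, `M`: `Re det (1 + (P M)^p) ≥ 1` (writing `M = Bᴴ B`, the determinant is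
`det (1 + (B P Bᴴ)^p) ≥ 1`). -/
theorem one_le_re_det_one_add_pow_mul {k : Type*} [Fintype k] [DecidableEq k] {P M : Matrix k k ℂ}
    (hP : P.PosSemidef) (hM : M.PosSemidef) (p : ℕ) : 1 ≤ ((1 + (P * M) ^ p).det).re := by
  -- adapted from `RectPattern.norm_det_one_add_pow_mul` (…CriticalLineDiamagnetismRectPattern.lean)
  obtain ⟨B, rfl⟩ := CStarAlgebra.nonneg_iff_eq_star_mul_self.mp hM.nonneg
  have h1 : (1 + (P * (star B * B)) ^ p).det = (1 + (B * P * Bᴴ) ^ p).det := by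
    rw [← Matrix.mul_assoc, RectPattern.det_one_add_pow_comm (P * star B) B p, Matrix.star_eq_conjTranspose,
      ← Matrix.mul_assoc]
  have h2 : (1 : ℂ) ≤ (1 + (B * P * Bᴴ) ^ p).det :=
    Summit.QuantumFields.QCD.Theorems.BackgroundSchwarz.one_le_det_one_add ((hP.mul_mul_conjTranspose_same B).pow p)
  rw [h1]
  have h := (Complex.le_def.1 h2).1
  rwa [Complex.one_re] at h

/-- An odd signed cyclic word: `∏_{i<2n+1} M_i (−W_i) = −∏_{i<2n+1} M_i W_i`. -/
theorem prod_map_mul_neg {k : Type*} [Fintype k] [DecidableEq k] (n : ℕ) (M W : ℕ → Matrix k k ℂ) :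
    ((List.range (2 * n + 1)).map fun i : ℕ => M i * -W i).prod =
      -((List.range (2 * n + 1)).map fun i : ℕ => M i * W i).prod := by
  have hf : (fun i : ℕ => M i * -W i) = fun i : ℕ => -(M i * W i) := funext fun i => Matrix.mul_neg _ _
  rw [hf, WilsonTransfer.prod_map_neg_eq_smul (fun i => M i * W i) (List.range (2 * n + 1)), List.length_range,
    pow_succ, pow_mul, neg_one_sq, one_pow, one_mul, neg_one_smul]

end ReflectionChain

end FrequencyDiamagnetism

/-! ### The registered helper theorem -/

open FrequencyDiamagnetism FrequencyDiamagnetism.RectPattern FrequencyDiamagnetism.ReflectionChain Matrix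
  Summit.QuantumFields.QCD.Cruxes.StableActionBridge.Sketch
  Summit.QuantumFields.QCD.Cruxes.WilsonQuarkStability.FreeTangentLandauChessboard in
/-- **Route B helper `reflectionChain`** (ONE application of Route B on the rectangular torus `ℤ/(2n+1) × ℤ/L₂`,
odd time length, at the reflection row `r`).  For `A : ℤ/(2n+1) → ℤ/L₂ → Fin 4 → U(3)`, `m > −1`, real frequencies
and a real `πf` bounding every row's static pressure `log e_s + p(M_s)` (`e_s = ‖det (A_sP⁻ − P⁺)‖`,
`M_s = oneStepR A s`, `p(M) = Σᵢ log max(μᵢ(M), 1)`), if `det D_A ≠ 0` then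
`log ‖det D_A‖ ≤ πf + (1/2n) Σ_{s ≠ r+n} log ‖det D_{pat_s}‖`, where `pat_s` is the closed-slab pattern of rows
`s, s+1` on `ℤ/(2n) × ℤ/L₂` (`rectPattern`).  Proof: Lüscher's transfer form `det D_A = (∏_t det E_t) det (1 − Ω)`
(`tfreqOpR_det_transfer_form`, `‖det E_t‖ = e_t` by `stub_normDetChainBlock`); the abstract chain `routeBAlgebra` with
the letters `M_s = oneStepR A s`, `W_s = −link2R A s` (so that `1 + ∏ M_s W_s = 1 − Ω` on the odd circle, and
`W_sᴴ M_s W_s = W̃_sᴴ M_s W̃_s` for the unsigned transporter `W̃_s`); the pure tiling terms are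
`‖det D_{pat_s}‖ / (e_s e_{s+1})^n` (`rectPattern`); logarithms and the row bookkeeping `bookkeeping` (every `e_t` is
counted `2n` times). -/
theorem reflectionChain : ∀ (n : ℕ) [NeZero n] (L₂ : ℕ) [NeZero L₂] (A : ZMod (2 * n + 1) → ZMod L₂ → Fin 4 → Matrix.unitaryGroup (Fin 3) ℂ) (m : ℝ), -1 < m → ∀ (ω₀ ω₁ πf : ℝ), (∀ (s : ZMod (2 * n + 1)) (hs : (oneStepR A m ω₀ ω₁ s).PosDef), Real.log ‖(sliceOpR A m ω₀ ω₁ s * projM L₂ - projP L₂).det‖ + ∑ i, Real.log (max (hs.1.eigenvalues i) 1) ≤ πf) → (tfreqOpR A m ω₀ ω₁).det ≠ 0 → ∀ r : ZMod (2 * n + 1), Real.log ‖(tfreqOpR A m ω₀ ω₁).det‖ ≤ πf + (1 / (2 * n : ℝ)) * ∑ s ∈ Finset.univ.erase (r + n), Real.log ‖(tfreqOpR (fun (σ : ZMod (2 * n)) (x : ZMod L₂) (μ : Fin 4) => if μ = 3 then (if σ.val % 2 = 0 then A s x 3 else A (s + 1) x 3) else if μ = 2 then (if σ.val % 2 = 0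 then A s x 2 else (A s x 2)⁻¹) else 1) m ω₀ ω₁).det‖ := by
  intro n _ L₂ _ A m hm ω₀ ω₁ πf hπ hD r
  have hn : 0 < n := Nat.pos_of_ne_zero (NeZero.ne n)
  -- Lüscher's transfer form of `det D_A` and the positivity of the one-step matrices
  obtain ⟨hdet, hMpos⟩ := tfreqOpR_det_transfer_form A hm ω₀ ω₁
  obtain ⟨Ω, hΩ⟩ : ∃ Ω : Matrix (ZMod L₂ × Fin 3 × Fin 4) (ZMod L₂ × Fin 3 × Fin 4) ℂ,
      Ω = ((List.range (2 * n + 1)).map fun i : ℕ =>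
        oneStepR A m ω₀ ω₁ (i : ZMod (2 * n + 1)) * link2R A (i : ZMod (2 * n + 1))).prod := ⟨_, rfl⟩
  rw [← hΩ] at hdet
  -- projections and transporters
  have hP : projP L₂ + projM L₂ = 1 := liftProjPlus_add_liftProjMinus (ZMod L₂) 3
  have hPQ : projP L₂ * projM L₂ = 0 := liftProjPlus_mul_liftProjMinus (ZMod L₂) 3
  have hQP : projM L₂ * projP L₂ = 0 := liftProjMinus_mul_liftProjPlus (ZMod L₂) 3
  have hPph : (projP L₂)ᴴ = projP L₂ := (slice_claimsR A hm ω₀ ω₁ 0).2.2.1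
  have hPmh : (projM L₂)ᴴ = projM L₂ := (slice_claimsR A hm ω₀ ω₁ 0).2.2.2.1
  have hsp := fun t : ZMod (2 * n + 1) => slice_spin_structureR A m ω₀ ω₁ t
  have hW'u : ∀ t, link2R' A t ∈ Matrix.unitaryGroup _ ℂ := fun t =>
    Matrix.mem_unitaryGroup_iff.mpr (by rw [star_link2R', (hsp t).2.2.2.2.2.2.2.2])
  have hWu : ∀ t, link2R A t ∈ Matrix.unitaryGroup _ ℂ := fun t => by
    rw [← star_link2R']
    exact Unitary.star_mem (hW'u t)
  have hnWu : ∀ t, -link2R A t ∈ Matrix.unitaryGroup _ ℂ := fun t => neg_mem_unitaryGroup (hWu t)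
  -- the e-factors `e_t = ‖det (A_tP⁻ − P⁺)‖ = ‖det E_t‖ > 0`
  obtain ⟨e, he⟩ : ∃ e : ZMod (2 * n + 1) → ℝ, ∀ t, e t = ‖(sliceOpR A m ω₀ ω₁ t * projM L₂ - projP L₂).det‖ :=
    ⟨_, fun _ => rfl⟩
  have he0 : ∀ t, 0 < e t := fun t => (he t) ▸ norm_det_sliceE_pos A hm ω₀ ω₁ t
  have hEV : ∀ t, ‖(sliceOpR A m ω₀ ω₁ t * projM L₂ - projP L₂ * link2R' A (t - 1)).det‖ = e t := fun t => by
    rw [he]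
    exact stub_normDetChainBlock _ _ _ _ hP hPQ hQP hPph hPmh (hW'u _) (hsp (t - 1)).2.2.2.2.2.2.1
      (hsp (t - 1)).2.2.2.2.2.2.2.1
  have hnormD : ‖(tfreqOpR A m ω₀ ω₁).det‖ = (∏ t, e t) * ‖(1 - Ω).det‖ := by
    rw [hdet, norm_mul, norm_prod, Finset.prod_congr rfl fun t _ => hEV t]
  have hΩ0 : 0 < ‖(1 - Ω).det‖ := by
    refine norm_pos_iff.mpr fun h0 => hD ?_
    rw [hdet, h0, mul_zero]
  -- the unsigned transporters `W̃_s` and the pure tiling terms `T_s = Re det (1 + (W̃_sᴴ M_s W̃_s M_{s+1})^n) ≥ 1`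
  obtain ⟨Wt, hWt⟩ : ∃ Wt : ZMod (2 * n + 1) → Matrix (ZMod L₂ × Fin 3 × Fin 4) (ZMod L₂ × Fin 3 × Fin 4) ℂ,
      ∀ s, Wt s = Matrix.of fun a b : ZMod L₂ × Fin 3 × Fin 4 =>
        if a.1 = b.1 ∧ a.2.2 = b.2.2 then (A s a.1 2 : Matrix (Fin 3) (Fin 3) ℂ) a.2.1 b.2.1 else 0 :=
    ⟨_, fun _ => rfl⟩
  have hQ : ∀ s, (-link2R A s)ᴴ * oneStepR A m ω₀ ω₁ s * -link2R A s * oneStepR A m ω₀ ω₁ (s + 1) =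
      (Wt s)ᴴ * oneStepR A m ω₀ ω₁ s * Wt s * oneStepR A m ω₀ ω₁ (s + 1) := fun s => by
    by_cases hs : s = -1
    · rw [link2R_eq_neg_colourLift A s (fun x => (A s x 2 : Matrix (Fin 3) (Fin 3) ℂ)) hs (fun x => rfl), ← hWt,
        neg_neg]
    · rw [link2R_eq_colourLift A s (fun x => (A s x 2 : Matrix (Fin 3) (Fin 3) ℂ)) hs (fun x => rfl), ← hWt,
        conjTranspose_neg, neg_mul, neg_mul, mul_neg, neg_neg]
  obtain ⟨T, hT⟩ : ∃ T : ZMod (2 * n + 1) → ℝ, ∀ s,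
      T s = ((1 + ((Wt s)ᴴ * oneStepR A m ω₀ ω₁ s * Wt s * oneStepR A m ω₀ ω₁ (s + 1)) ^ n).det).re :=
    ⟨_, fun _ => rfl⟩
  have hT0 : ∀ s, 0 < T s := fun s => lt_of_lt_of_le zero_lt_one ((hT s) ▸
    one_le_re_det_one_add_pow_mul ((hMpos s).posSemidef.conjTranspose_mul_mul_same (Wt s))
      (hMpos (s + 1)).posSemidef n)
  -- the pressures `p_s = ∏ᵢ max(μᵢ(M_s), 1) ≥ 1`
  obtain ⟨p, hp⟩ : ∃ p : ZMod (2 * n + 1) → ℝ, ∀ s, p s = ∏ i, max ((hMpos s).1.eigenvalues i) 1 :=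
    ⟨_, fun _ => rfl⟩
  have hmax0 : ∀ (s) (i : ZMod L₂ × Fin 3 × Fin 4), (0 : ℝ) < max ((hMpos s).1.eigenvalues i) 1 := fun s i =>
    lt_of_lt_of_le zero_lt_one (le_max_right _ _)
  have hp0 : ∀ s, 0 < p s := fun s => (hp s) ▸ Finset.prod_pos fun i _ => hmax0 s i
  -- Route B: the abstract chain with the letters `M_s = oneStepR A s`, `W_s = −link2R A s`
  have hRB : (‖(1 - Ω).det‖ ^ 2) ^ n ≤
      (p (r + n) * p (r + n + 1)) ^ n * (∏ t : Fin n, T (r + t)) * ∏ t : Fin n, T (r + n + 1 + t) := by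
    have h := routeBAlgebra n hn (oneStepR A m ω₀ ω₁) hMpos (fun i => -link2R A i) hnWu r
    rw [prod_map_mul_neg n (fun i => oneStepR A m ω₀ ω₁ (i : ZMod (2 * n + 1)))
      (fun i => link2R A (i : ZMod (2 * n + 1))), ← hΩ, ← sub_eq_add_neg] at h
    simp only [hQ] at h
    simpa only [hp, hT] using h
  -- logarithms
  have hlogD : Real.log ‖(tfreqOpR A m ω₀ ω₁).det‖ = ∑ t, Real.log (e t) + Real.log ‖(1 - Ω).det‖ := by
    rw [hnormD, Real.log_mul (Finset.prod_pos fun t _ => he0 t).ne' hΩ0.ne', Real.log_prod]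
    exact fun t _ => (he0 t).ne'
  have hlogRB : (n : ℝ) * (2 * Real.log ‖(1 - Ω).det‖) ≤
      n * (Real.log (p (r + n)) + Real.log (p (r + n + 1))) + ∑ t : Fin n, Real.log (T (r + t)) +
        ∑ t : Fin n, Real.log (T (r + n + 1 + t)) := by
    have hpp : (p (r + n) * p (r + n + 1)) ^ n ≠ 0 := (pow_pos (mul_pos (hp0 _) (hp0 _)) n).ne'
    have hT1 : ∏ t : Fin n, T (r + t) ≠ 0 := (Finset.prod_pos fun t _ => hT0 _).ne'
    have hT2 : ∏ t : Fin n, T (r + n + 1 + t) ≠ 0 := (Finset.prod_pos fun t _ => hT0 _).ne'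
    have h := Real.log_le_log (pow_pos (pow_pos hΩ0 2) n) hRB
    rw [Real.log_pow, Real.log_pow, Nat.cast_ofNat, Real.log_mul (mul_ne_zero hpp hT1) hT2, Real.log_mul hpp hT1,
      Real.log_pow, Real.log_mul (hp0 _).ne' (hp0 _).ne', Real.log_prod, Real.log_prod] at h
    · exact h
    · exact fun t _ => (hT0 _).ne'
    · exact fun t _ => (hT0 _).ne'
  have hlogpat : ∀ s : ZMod (2 * n + 1), Real.log ‖(tfreqOpR (fun (σ : ZMod (2 * n)) (x : ZMod L₂) (μ : Fin 4) =>
      if μ = 3 then (if σ.val % 2 = 0 then A s x 3 else A (s + 1) x 3)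
      else if μ = 2 then (if σ.val % 2 = 0 then A s x 2 else (A s x 2)⁻¹) else 1) m ω₀ ω₁).det‖ =
      n * Real.log (e s) + n * Real.log (e (s + 1)) + Real.log (T s) := fun s => by
    have h : ‖(tfreqOpR (fun (σ : ZMod (2 * n)) (x : ZMod L₂) (μ : Fin 4) =>
        if μ = 3 then (if σ.val % 2 = 0 then A s x 3 else A (s + 1) x 3)
        else if μ = 2 then (if σ.val % 2 = 0 then A s x 2 else (A s x 2)⁻¹) else 1) m ω₀ ω₁).det‖ =
        e s ^ n * e (s + 1) ^ n * T s := by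
      rw [he, he, hT, hWt]
      exact rectPattern n (2 * n + 1) L₂ A s m hm ω₀ ω₁
    rw [h, Real.log_mul (mul_pos (pow_pos (he0 _) n) (pow_pos (he0 _) n)).ne' (hT0 _).ne',
      Real.log_mul (pow_pos (he0 _) n).ne' (pow_pos (he0 _) n).ne', Real.log_pow, Real.log_pow]
  have hlogπ : ∀ s, Real.log (e s) + Real.log (p s) ≤ πf := fun s => by
    rw [he, hp, Real.log_prod]
    · exact hπ s (hMpos s)
    · exact fun i _ => (hmax0 s i).ne'
  -- the row bookkeeping
  exact bookkeeping hn r (fun t => Real.log (e t)) (fun t => Real.log (p t)) (fun t => Real.log (T t)) _ _ _ πf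
    hlogD hlogRB hlogpat hlogπ

end Summit.QuantumFields.QCD.Cruxes.CriticalLineDiamagnetism.ChessboardCellGain

end
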